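import Summits.HodgeConjecture.HodgeConjecture.Theorems.K2E3WittBoundedCartan        -- (this seat) T2 F4: `exists_bounded_frameDiag`
import Literature.NumberTheory.Automorphic.AnisotropicUnitaryGroupCompact            -- ★ coercivity `exists_forall_v_sq_le_v_hermForm_self`, `isCompact_setOf_v_apply_le_exp`
import Literature.NumberTheory.Automorphic.UnitaryGroupOfFormAdelicTopology           -- ★ `isClosed_unitaryGroupOfForm`
import HarnessLib

/-!
# The letter `hrawΩ` PACKAGED: the bounded Cartan decomposition of `U(σ, wittFormOn e Han)(K)` over a complete discretely valued field with compact integers,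
# for EVERY anisotropic kernel and EVERY isometric involution (crux H413, U12-g ∕ 13a road A, hand (T2); consumer K2E3-p10 (g4) P1–P3)

Cell `hodgecm-mathlib`, Track B «K2-LIT», line `K2_E3_EllipticInputs`, 13a road A (line lead K2E3-p10 (g4)); seat K2E3-p09 (g3).  THEOREMS ONLY;
`--supports stmt-HodgeConjecture-24833 --as helper`.

★ `K2E3WittBoundedCartan.exists_bounded_frameDiag` proves the frame-diagonalisation `k₁ g k₂` with `B^n`-bounded `k₁, k₂ ∈ U(σ, W)` from four hypotheses on the kernel
(`B ≥ 1`, `v(Han) ≤ B`, `v(Han⁻¹) ≤ B`, coercivity).  Here: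

* §1 **`exists_kernelDatum`** — over `K` with `𝒪[K]` compact and a uniformiser, every σ-hermitian ANISOTROPIC `Han` admits such a `B = exp b` (★ coercivity
  `exists_forall_v_sq_le_v_hermForm_self`, finitely many entries).
* §2 **structure of a frame-diagonal element of `U(σ, W)`**: the frame diagonal satisfies the norm condition `σ(X_{pp}) X_{rev p, rev p} = 1` (`frameDiag_norm`) and the
  kernel block is `Han`-unitary (`frameDiag_kernel_unitary`).
* §3 **`exists_rawCartanSet`** — THE LETTER `hrawΩ`: `∃ b : ℕ, ∀ g ∈ U(σ, wittFormOn e Han), ∃ k₁ k₂ ∈ U`, all entries of `k₁^{±1}, k₂^{±1}` bounded by `exp b`, `k₁ g k₂`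
  frame-diagonal (hence `= diag(d)|_frame ⊕ h|_kernel` with `σ(d_p) d_{rev p} = 1`, `h ∈ U(σ, Han)` by §2); and **`isCompact_boundedSet`**: the set
  `Ω_b = {k ∈ U : v(k_{ij}) ≤ exp b ∧ v(k⁻¹_{ij}) ≤ exp b}` is COMPACT (★ `isCompact_setOf_v_apply_le_exp` pulled back along the closed embedding `U ↪ GL_N`).

So `U = Ω_b · (T · U(Han)) · Ω_b` at EVERY place — no uniformiser enters the decomposition, no (trace), no (norm), no lattice normalisation of the kernel; this is the
input of K2E3-p10 (g4)'s set-currency packaging (`hG`, `hLevi(S)`, `hGC` of ★ p856653) which closes 13a at the WILDLY RAMIFIED `m = 2` places.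
HONEST LABEL: structure theorem; HC_CM is proved only modulo the 7 printed citations (2 remaining named inputs: hLiu418 = stmt-HodgeConjecture-24832, h413 =
stmt-HodgeConjecture-24833) until rung 0 closes; 13a is ★ at odd `N` only.

References: F. Bruhat, J. Tits, *Groupes réductifs sur un corps local I* (1972), (4.4.3); V. Platonov, A. Rapinchuk, *Algebraic Groups and Number Theory* (1994), §3.1
Thm. 3.1; A. Weil, *Basic Number Theory* (1967), Ch. II §§1–2.
-/

set_option autoImplicit false
-- the mandated namespace repeats `HodgeConjecture.HodgeConjecture`, as in every `Theorems/*.lean` of this sub-problem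
set_option linter.dupNamespace false

noncomputable section

open scoped Valued WithZero Matrix MatrixGroups Topology
open Matrix

namespace Summit.HodgeConjecture.HodgeConjecture.Cruxes.H413.K2E3WittBoundedCartanPackage

open Literature.NumberTheory.Automorphic Literature.NumberTheory.Automorphic.UnitaryGroup Literature.NumberTheory.Automorphic.HermitianLattice
open Literature.NumberTheory.Automorphic.SymplecticCartan
open K2E3LocalUnitaryWitt K2E3WittCartanUnramified K2E3WittParabolicBlocks K2E3WittFrameTools K2E3WittBoundedPivot K2E3WittBoundedStep K2E3WittBoundedCartan

/-! ## §1 The kernel datum over a field with compact integers -/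

section Datum

variable {K : Type*} [Field K] [Valued K ℤᵐ⁰] {ϖ : K} (σ : K →+* K) {m : ℕ} (Han : Matrix (Fin m) (Fin m) K)

/-- **The kernel datum**: for `𝒪[K]` compact, `ϖ` a uniformiser, `σ` isometric and `Han` ANISOTROPIC there is ONE `b : ℕ` with `v(Han) ≤ exp b`, `v(Han⁻¹) ≤ exp b` and the
coercivity `v(z_u)² ≤ exp b · v(Han(z, z))`. [cite: PlatonovRapinchuk1994, §3.1 Thm. 3.1] [cite: WeilBNT1967, Ch. II §1 Prop. 2] -/
theorem exists_kernelDatum [CompactSpace 𝒪[K]] (hϖ : Valued.v ϖ = WithZero.exp (-1 : ℤ)) (hvσ : ∀ x, Valued.v (σ x) = Valued.v x)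
    (han : ∀ z : Fin m → K, hermForm σ Han z z = 0 → z = 0) :
    ∃ b : ℕ, (1 : ℤᵐ⁰) ≤ WithZero.exp (b : ℤ) ∧ (∀ u u', Valued.v (Han u u') ≤ WithZero.exp (b : ℤ)) ∧ (∀ u u', Valued.v (Han⁻¹ u u') ≤ WithZero.exp (b : ℤ)) ∧
      ∀ (z : Fin m → K) (u : Fin m), Valued.v (z u) * Valued.v (z u) ≤ WithZero.exp (b : ℤ) * Valued.v (hermForm σ Han z z) := by
  obtain ⟨m₀, hm₀⟩ := exists_forall_v_sq_le_v_hermForm_self hϖ hvσ han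
  obtain ⟨M₁, hM₁⟩ := exists_forall_v_le_exp_of_isCompact hϖ (Set.finite_range fun p : Fin m × Fin m => Han p.1 p.2).isCompact
  obtain ⟨M₂, hM₂⟩ := exists_forall_v_le_exp_of_isCompact hϖ (Set.finite_range fun p : Fin m × Fin m => Han⁻¹ p.1 p.2).isCompact
  have hmono : ∀ {a b : ℕ}, a ≤ b → WithZero.exp (a : ℤ) ≤ WithZero.exp (b : ℤ) := fun h => WithZero.exp_le_exp.2 (by exact_mod_cast h)
  refine ⟨m₀ + M₁ + M₂, ?_, fun u u' => (hM₁ _ ⟨(u, u'), rfl⟩).trans (hmono (by omega)), fun u u' => (hM₂ _ ⟨(u, u'), rfl⟩).trans (hmono (by omega)), fun z u => ?_⟩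
  · rw [← WithZero.exp_zero]; exact WithZero.exp_le_exp.2 (by positivity)
  · have h := hm₀ z u
    have hexp : WithZero.exp (-(m₀ : ℤ)) * WithZero.exp (m₀ : ℤ) = 1 := by rw [← WithZero.exp_add, neg_add_cancel, WithZero.exp_zero]
    calc Valued.v (z u) * Valued.v (z u) = Valued.v (z u) * Valued.v (z u) * WithZero.exp (-(m₀ : ℤ)) * WithZero.exp (m₀ : ℤ) := by rw [mul_assoc, hexp, mul_one]
      _ ≤ Valued.v (hermForm σ Han z z) * WithZero.exp (m₀ : ℤ) := mul_le_mul' h le_rfl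
      _ ≤ Valued.v (hermForm σ Han z z) * WithZero.exp ((m₀ + M₁ + M₂ : ℕ) : ℤ) := mul_le_mul' le_rfl (hmono (by omega))
      _ = _ := mul_comm _ _

end Datum

/-! ## §2 Structure of a frame-diagonal element of `U(σ, W)` -/

section Structure

variable {K : Type*} [Field K] (σ : K →+* K) {N r m : ℕ} (e : WittIndex r m ≃ Fin N)
  (hstd : ∀ x, (e x).val = Sum.elim (fun i : Fin r => i.val) (Sum.elim (fun u : Fin m => r + u.val) (fun j : Fin r => r + m + j.val)) x)
  (Han : Matrix (Fin m) (Fin m) K)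

include hstd in
/-- **Norm condition on the frame diagonal**: for a frame-diagonal `X ∈ U(σ, W)` and a frame slot `p`, `σ(X_{pp}) · X_{rev p, rev p} = 1` (the columns `X e_p = X_{pp} e_p`,
`X e_{rev p} = X_{rev p, rev p} e_{rev p}` pair to `h(e_p, e_{rev p}) = 1`). [cite: BruhatTits1972, (4.4.3)] -/
theorem frameDiag_norm (X : unitaryGroupOfForm σ (wittFormOn e Han))
    (hX : ∀ p q : Fin N, p ≠ q → ((∀ u : Fin m, p ≠ e (Sum.inr (Sum.inl u))) ∨ (∀ u : Fin m, q ≠ e (Sum.inr (Sum.inl u)))) →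
      ((X : GL (Fin N) K) : Matrix (Fin N) (Fin N) K) p q = 0)
    {p : Fin N} (hp : ∀ u : Fin m, p ≠ e (Sum.inr (Sum.inl u))) :
    σ (((X : GL (Fin N) K) : Matrix (Fin N) (Fin N) K) p p) * ((X : GL (Fin N) K) : Matrix (Fin N) (Fin N) K) (Fin.rev p) (Fin.rev p) = 1 := by
  set A : Matrix (Fin N) (Fin N) K := ((X : GL (Fin N) K) : Matrix (Fin N) (Fin N) K) with hA
  have hU : (A.map σ)ᵀ * wittFormOn e Han * A = wittFormOn e Han := mem_unitaryGroupOfForm_iff.1 X.2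
  have hpr := frame_rev e hstd hp
  have hcol : ∀ {a : Fin N}, (∀ u : Fin m, a ≠ e (Sum.inr (Sum.inl u))) → A *ᵥ Pi.single a 1 = A a a • Pi.single a 1 := by
    intro a ha
    rw [K2E3WittFrameTools.mulVec_single_one]
    ext i
    rw [Pi.smul_apply, smul_eq_mul, Pi.single_apply]
    by_cases h : i = a
    · subst h; rw [if_pos rfl, mul_one]
    · rw [if_neg h, mul_zero]; exact hX i a h (Or.inr ha)
  have h := hermForm_mulVec σ hU (Pi.single p 1) (Pi.single (Fin.rev p) 1)
  rw [hcol hp, hcol hpr, hermForm_smul_left_eq, UnitaryGroup.hermForm_smul_right, hermForm_single_single_frame σ e hstd Han hp, if_pos rfl, mul_one] at h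
  rw [← h]

include hstd in
/-- **The kernel block of a frame-diagonal `X ∈ U(σ, W)` is `Han`-unitary**: `(h.map σ)ᵀ Han h = Han` for `h_{u u′} = X_{e u, e u′}` (the kernel columns of `X` have no
frame part; on kernel-supported vectors `h_W = h_{Han}`). [cite: BruhatTits1972, (4.4.3)] -/
theorem frameDiag_kernel_unitary (X : unitaryGroupOfForm σ (wittFormOn e Han))
    (hX : ∀ p q : Fin N, p ≠ q → ((∀ u : Fin m, p ≠ e (Sum.inr (Sum.inl u))) ∨ (∀ u : Fin m, q ≠ e (Sum.inr (Sum.inl u)))) →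
      ((X : GL (Fin N) K) : Matrix (Fin N) (Fin N) K) p q = 0) :
    ((Matrix.of fun u u' : Fin m => ((X : GL (Fin N) K) : Matrix (Fin N) (Fin N) K) (e (Sum.inr (Sum.inl u))) (e (Sum.inr (Sum.inl u')))).map σ)ᵀ * Han *
        (Matrix.of fun u u' : Fin m => ((X : GL (Fin N) K) : Matrix (Fin N) (Fin N) K) (e (Sum.inr (Sum.inl u))) (e (Sum.inr (Sum.inl u')))) = Han := by
  set A : Matrix (Fin N) (Fin N) K := ((X : GL (Fin N) K) : Matrix (Fin N) (Fin N) K) with hA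
  set h : Matrix (Fin m) (Fin m) K := Matrix.of fun u u' : Fin m => A (e (Sum.inr (Sum.inl u))) (e (Sum.inr (Sum.inl u'))) with hh
  have hU : (A.map σ)ᵀ * wittFormOn e Han * A = wittFormOn e Han := mem_unitaryGroupOfForm_iff.1 X.2
  -- the kernel columns of `A` and their pairings
  have hframe0 : ∀ {p : Fin N}, (∀ u : Fin m, p ≠ e (Sum.inr (Sum.inl u))) → ∀ u₀ : Fin m, A p (e (Sum.inr (Sum.inl u₀))) = 0 :=
    fun hp u₀ => hX _ _ (hp u₀) (Or.inl hp)
  have hpair : ∀ u₀ u₁ : Fin m, hermForm σ Han (fun u => h u u₀) (fun u => h u u₁) = Han u₀ u₁ := by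
    intro u₀ u₁
    have h1 := hermForm_mulVec σ hU (Pi.single (e (Sum.inr (Sum.inl u₀))) 1) (Pi.single (e (Sum.inr (Sum.inl u₁))) 1)
    rw [hermForm_single_single, wittFormOn_kernel_kernel, K2E3WittFrameTools.mulVec_single_one, K2E3WittFrameTools.mulVec_single_one,
      hermForm_witt_eq σ e hstd Han] at h1
    have hz1 : ∀ i : Fin r, A (e (Sum.inl i)) (e (Sum.inr (Sum.inl u₀))) = 0 := fun i => hframe0 (fun u h' => Sum.inl_ne_inr (e.injective h')) u₀
    have hz2 : ∀ j : Fin r, A (e (Sum.inr (Sum.inr j))) (e (Sum.inr (Sum.inl u₀))) = 0 := fun j =>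
      hframe0 (fun u h' => by have := e.injective h'; simp at this) u₀
    simp only [hz1, hz2, map_zero, zero_mul, Finset.sum_const_zero, zero_add] at h1
    exact h1
  rw [transpose_map_mul_mul_eq_iff_hermForm]
  intro v w
  -- bilinear expansion through the columns
  have hv : h *ᵥ v = ∑ u₀, v u₀ • fun u => h u u₀ := by
    ext u; simp [Matrix.mulVec, dotProduct, Finset.sum_apply, mul_comm]
  have hw : h *ᵥ w = ∑ u₁, w u₁ • fun u => h u u₁ := by
    ext u; simp [Matrix.mulVec, dotProduct, Finset.sum_apply, mul_comm]
  have hR : hermForm σ Han v w = ∑ u₀, σ (v u₀) * ∑ u₁, w u₁ * Han u₀ u₁ := by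
    rw [hermForm_apply, dotProduct]
    refine Finset.sum_congr rfl fun u₀ _ => ?_
    rw [Function.comp_apply, Matrix.mulVec, dotProduct]
    congr 1
    exact Finset.sum_congr rfl fun u₁ _ => mul_comm _ _
  rw [hv, hw, hR]
  rw [show hermForm σ Han (∑ u₀, v u₀ • fun u => h u u₀) (∑ u₁, w u₁ • fun u => h u u₁) =
      ∑ u₀, σ (v u₀) * ∑ u₁, w u₁ * hermForm σ Han (fun u => h u u₀) (fun u => h u u₁) from ?_]
  · exact Finset.sum_congr rfl fun u₀ _ => by rw [Finset.sum_congr rfl fun u₁ _ => by rw [hpair]]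
  -- sesquilinearity, by induction-free sums
  have hL : ∀ (y : Fin m → K), hermForm σ Han (∑ u₀, v u₀ • fun u => h u u₀) y = ∑ u₀, σ (v u₀) * hermForm σ Han (fun u => h u u₀) y := by
    intro y
    rw [hermForm_apply, dotProduct]
    simp only [Function.comp_apply, Finset.sum_apply, Pi.smul_apply, smul_eq_mul, map_sum, map_mul, Finset.sum_mul]
    rw [Finset.sum_comm]
    refine Finset.sum_congr rfl fun u₀ _ => ?_
    rw [hermForm_apply, dotProduct, Finset.mul_sum]
    refine Finset.sum_congr rfl fun u _ => ?_
    rw [Function.comp_apply]; ring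
  have hRt : ∀ (x : Fin m → K), hermForm σ Han x (∑ u₁, w u₁ • fun u => h u u₁) = ∑ u₁, w u₁ * hermForm σ Han x (fun u => h u u₁) := by
    intro x
    rw [hermForm_apply, Matrix.mulVec_sum, dotProduct_sum]
    refine Finset.sum_congr rfl fun u₁ _ => ?_
    rw [Matrix.mulVec_smul, dotProduct_smul, smul_eq_mul, hermForm_apply]
  rw [hL]
  exact Finset.sum_congr rfl fun u₀ _ => by rw [hRt]

end Structure

/-! ## §3 The letter `hrawΩ` and the compact set `Ω_b` -/

section Letter

variable {K : Type*} [Field K] [Valued K ℤᵐ⁰] {ϖ : K} {σ : K →+* K} {N r m : ℕ} (e : WittIndex r m ≃ Fin N)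
  (hstd : ∀ x, (e x).val = Sum.elim (fun i : Fin r => i.val) (Sum.elim (fun u : Fin m => r + u.val) (fun j : Fin r => r + m + j.val)) x)
  (Han : Matrix (Fin m) (Fin m) K)

include hstd in
/-- **THE LETTER `hrawΩ` — the bounded Cartan decomposition of `U(σ, wittFormOn e Han)(K)` for EVERY anisotropic kernel and EVERY isometric involution** (`𝒪[K]` compact,
`ϖ` a uniformiser — used only to produce the kernel datum): one `b : ℕ` such that every `g ∈ U` is `k₁⁻¹ X k₂⁻¹` with `X = k₁ g k₂` FRAME-DIAGONAL and all entries of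
`k₁, k₁⁻¹, k₂, k₂⁻¹` bounded by `exp b`. [cite: BruhatTits1972, (4.4.3)] [cite: Tits1979, §3.3.3] [cite: PlatonovRapinchuk1994, §3.1 Thm. 3.1] -/
theorem exists_rawCartanSet [CompactSpace 𝒪[K]] (hϖ : Valued.v ϖ = WithZero.exp (-1 : ℤ)) (hσ : ∀ x, σ (σ x) = x) (hvσ : ∀ x, Valued.v (σ x) = Valued.v x)
    (hHanh : (Han.map σ)ᵀ = Han) (han : ∀ z : Fin m → K, hermForm σ Han z z = 0 → z = 0) :
    ∃ b : ℕ, ∀ g : unitaryGroupOfForm σ (wittFormOn e Han), ∃ k₁ k₂ : unitaryGroupOfForm σ (wittFormOn e Han),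
      (∀ i j, Valued.v (((k₁ : GL (Fin N) K) : Matrix (Fin N) (Fin N) K) i j) ≤ WithZero.exp (b : ℤ)) ∧
      (∀ i j, Valued.v ((((k₁⁻¹ : unitaryGroupOfForm σ (wittFormOn e Han)) : GL (Fin N) K) : Matrix (Fin N) (Fin N) K) i j) ≤ WithZero.exp (b : ℤ)) ∧
      (∀ i j, Valued.v (((k₂ : GL (Fin N) K) : Matrix (Fin N) (Fin N) K) i j) ≤ WithZero.exp (b : ℤ)) ∧
      (∀ i j, Valued.v ((((k₂⁻¹ : unitaryGroupOfForm σ (wittFormOn e Han)) : GL (Fin N) K) : Matrix (Fin N) (Fin N) K) i j) ≤ WithZero.exp (b : ℤ)) ∧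
      ∀ p q : Fin N, p ≠ q → ((∀ u : Fin m, p ≠ e (Sum.inr (Sum.inl u))) ∨ (∀ u : Fin m, q ≠ e (Sum.inr (Sum.inl u)))) →
        (((k₁ * g * k₂ : unitaryGroupOfForm σ (wittFormOn e Han)) : GL (Fin N) K) : Matrix (Fin N) (Fin N) K) p q = 0 := by
  have hHan : IsUnit Han.det := by
    -- anisotropic ⟹ non-degenerate
    rw [isUnit_iff_ne_zero]
    intro h0
    obtain ⟨z, hz0, hz⟩ := Matrix.exists_mulVec_eq_zero_iff.2 h0
    apply hz0
    apply han
    rw [hermForm_apply, hz, dotProduct_zero]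
  obtain ⟨b₀, hB1, hHanB, hHaniB, hcoer⟩ := exists_kernelDatum σ Han hϖ hvσ han
  obtain ⟨n, hn⟩ := exists_bounded_frameDiag Han hσ hvσ hHanh hHan hB1 hHanB hHaniB hcoer r
  have hW : ∀ p q, Valued.v (wittFormOn e Han p q) ≤ WithZero.exp (b₀ : ℤ) := v_wittFormOn_le e hstd Han hB1 hHanB
  have hWi : ∀ p q, Valued.v (wittFormOn e Han⁻¹ p q) ≤ WithZero.exp (b₀ : ℤ) := v_wittFormOn_le e hstd Han⁻¹ hB1 hHaniB
  refine ⟨(n + 2) * b₀, fun g => ?_⟩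
  obtain ⟨k₁, k₂, hk₁, hk₂, hdiag⟩ := hn e hstd g
  have hpow : ∀ k : ℕ, WithZero.exp (b₀ : ℤ) ^ k = WithZero.exp ((k * b₀ : ℕ) : ℤ) := fun k => by
    rw [← WithZero.exp_nsmul, nsmul_eq_mul]; push_cast; ring_nf
  have hmono : WithZero.exp ((n * b₀ : ℕ) : ℤ) ≤ WithZero.exp (((n + 2) * b₀ : ℕ) : ℤ) := WithZero.exp_le_exp.2 (by push_cast; nlinarith)
  have hinv : ∀ k : unitaryGroupOfForm σ (wittFormOn e Han), (∀ i j, Valued.v (((k : GL (Fin N) K) : Matrix (Fin N) (Fin N) K) i j) ≤ WithZero.exp (b₀ : ℤ) ^ n) →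
      ∀ i j, Valued.v ((((k⁻¹ : unitaryGroupOfForm σ (wittFormOn e Han)) : GL (Fin N) K) : Matrix (Fin N) (Fin N) K) i j) ≤ WithZero.exp (((n + 2) * b₀ : ℕ) : ℤ) := by
    intro k hk i j
    have h := v_inv_apply_le σ e Han hvσ hHan k hW hWi hk i j
    calc _ ≤ WithZero.exp (b₀ : ℤ) * WithZero.exp (b₀ : ℤ) ^ n * WithZero.exp (b₀ : ℤ) := h
      _ = WithZero.exp (b₀ : ℤ) ^ (n + 2) := by rw [pow_add, pow_two]; ac_rfl
      _ = _ := hpow (n + 2)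
  refine ⟨k₁, k₂, fun i j => ?_, hinv k₁ hk₁, fun i j => ?_, hinv k₂ hk₂, hdiag⟩
  · exact ((hk₁ i j).trans (le_of_eq (hpow n))).trans hmono
  · exact ((hk₂ i j).trans (le_of_eq (hpow n))).trans hmono

omit hstd in
/-- **The bounded set `Ω_b = {k ∈ U(σ, W) : v(k_{ij}) ≤ exp b, v(k⁻¹_{ij}) ≤ exp b}` is COMPACT** (`𝒪[K]` compact, `σ` isometric): ★ `isCompact_setOf_v_apply_le_exp` in `GL_N`
pulled back along the closed embedding `U(σ, W) ↪ GL_N(K)` (★ `isClosed_unitaryGroupOfForm`). [cite: WeilBNT1967, Ch. II §2] [cite: PlatonovRapinchuk1994, §3.1] -/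
theorem isCompact_boundedSet [CompactSpace 𝒪[K]] (hϖ : Valued.v ϖ = WithZero.exp (-1 : ℤ)) (hvσ : ∀ x, Valued.v (σ x) = Valued.v x) (b : ℕ) :
    IsCompact {k : unitaryGroupOfForm σ (wittFormOn e Han) |
      (∀ i j, Valued.v (((k : GL (Fin N) K) : Matrix (Fin N) (Fin N) K) i j) ≤ WithZero.exp (b : ℤ)) ∧
      ∀ i j, Valued.v ((((k⁻¹ : unitaryGroupOfForm σ (wittFormOn e Han)) : GL (Fin N) K) : Matrix (Fin N) (Fin N) K) i j) ≤ WithZero.exp (b : ℤ)} := by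
  have hcl : IsClosed ((unitaryGroupOfForm σ (wittFormOn e Han) : Subgroup (GL (Fin N) K)) : Set (GL (Fin N) K)) :=
    isClosed_unitaryGroupOfForm (continuous_of_forall_v_eq hvσ) _
  have hemb : Topology.IsClosedEmbedding (Subtype.val : unitaryGroupOfForm σ (wittFormOn e Han) → GL (Fin N) K) := hcl.isClosedEmbedding_subtypeVal
  have h := hemb.isCompact_preimage (isCompact_setOf_v_apply_le_exp (n := Fin N) hϖ b)
  convert h using 1
  ext k
  simp only [Set.mem_setOf_eq, Set.mem_preimage, Subgroup.coe_inv]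

end Letter

end Summit.HodgeConjecture.HodgeConjecture.Cruxes.H413.K2E3WittBoundedCartanPackage

end
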